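import Summits.AtomisticToContinuum.HydrodynamicLimit.Theorems.JParityClosureLocalSecondLawEquilibriumDefs
import Summits.AtomisticToContinuum.HydrodynamicLimit.Theorems.JParityClosureLocalSecondLawKineticStressAlgebra

/-!
# Equilibrium stub `eq_majorant`: deterministic majorant of the static `L¹` integrand

Registered stub of the equilibrium side-composition of line `exact-entropy-ledger-three-passivities` for the crux
`JParityClosure.LocalSecondLaw` (stmt-AtomisticToContinuum-13081, lead c2).  Configuration by configuration (no
probability), the static `L¹` integrand `Ystat σ Θ ū r w x = |HsT − H̄| + ∑ₖ |HsT·(m_k/ρ_r) − H̄ ūₖ|`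
(`H̄ = Hs σ 1 Θ`, `HsT = Hs σ ρ_r θ_r · cutRho ρ_r`) is bounded by `C (1 + e_r + coldTerm)` with a constant `C`
depending only on `(σ, Θ, ū, η₀, F)`:

* off the guard (`ρ_r ≤ 0` or `θ_r ≤ 0`) or above the density cutoff (`ρ_r ≥ 3`), `HsT = 0` and `Ystat` is the
  constant `|H̄| + ∑ₖ |H̄ ūₖ|`;
* on `0 < ρ_r < 3`, `0 < θ_r`: `Hs σ ρ θ = −ρ g`, `g = (3/2) log θ − log ρ − f_ex(ρσ³)` with `0 ≤ f_ex(ρσ³) = F(ρσ³) ≤ M`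
  (EOS band, `3σ³ < η₀`, `F` continuous on `[0, 3σ³]`); `|HsT| ≤ ρ|g|`, `|HsT·m_k/ρ| ≤ |g|·|m_k|`, and the
  elementary inequalities `m_k² ≤ 2ρ_r e_r` (Cauchy–Schwarz, i.e. `ρ_rθ_r ≥ 0`), `ρ_rθ_r ≤ (2/3)e_r`,
  `ρ log²ρ ≤ 12` on `(0,3)`, `log²θ ≤ 2θ` for `θ ≥ 1`, `log²θ ≤ log²(Θ/4)` for `Θ/4 < θ < 1` (warm branch) and
  `ρ(1 + log²θ) = coldTerm` for `θ ≤ Θ/4` (cold branch, `cutTheta = 1`) give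
  `ρ|g| + ∑ₖ|g||m_k| ≤ 100(1 + log²(Θ/4) + M + M²)(1 + e_r + coldTerm)`.

References: H. Spohn, *Large Scale Dynamics of Interacting Particles* (1991), Part I §2.3 (the entropy density of the
hard-sphere gas); folklore real analysis.
-/

noncomputable section

namespace Summit.AtomisticToContinuum.HydrodynamicLimit.Theorems.LocalSecondLawEquilibrium

open scoped BigOperators Topology Classical MeasureTheory ENNReal InnerProductSpace
open Filter Set MeasureTheory
open Literature.MathematicalPhysics.KineticTheory
open Literature.Analysis.FluidPDE
open Summit.AtomisticToContinuum.HydrodynamicLimit.Theorems.LocalSecondLawNegative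
open Summit.AtomisticToContinuum.HydrodynamicLimit.Theorems.LocalSecondLawLedger

variable {N : ℕ}

/-- `ρ log² ρ ≤ 12` on `(0, 3)` (in fact `≤ 2` below `1` by `1 + t + t²/2 ≤ eᵗ`, and `log ρ ≤ ρ - 1 < 2` above). -/
theorem eqM_mul_log_sq_le {ρ : ℝ} (hρ : 0 < ρ) (hρ3 : ρ < 3) : ρ * Real.log ρ ^ 2 ≤ 12 := by
  rcases le_or_gt ρ 1 with h1 | h1
  · have ht : 0 ≤ -Real.log ρ := by
      have := Real.log_nonpos hρ.le h1
      linarith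
    have h2 := Real.quadratic_le_exp_of_nonneg ht
    rw [Real.exp_neg, Real.exp_log hρ] at h2
    have h3 : ρ * (1 + -Real.log ρ + (-Real.log ρ) ^ 2 / 2) ≤ 1 := by
      calc ρ * (1 + -Real.log ρ + (-Real.log ρ) ^ 2 / 2) ≤ ρ * ρ⁻¹ := mul_le_mul_of_nonneg_left h2 hρ.le
        _ = 1 := mul_inv_cancel₀ hρ.ne'
    have h4 : 0 ≤ ρ * -Real.log ρ := mul_nonneg hρ.le ht
    nlinarith
  · have h2 : 0 ≤ Real.log ρ := Real.log_nonneg h1.le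
    have h3 : Real.log ρ ≤ ρ - 1 := Real.log_le_sub_one_of_pos hρ
    have h5 : Real.log ρ ^ 2 ≤ 4 := by nlinarith
    nlinarith

/-- For `θ ≥ 1`: `log² θ ≤ 2θ` (from `1 + u + u²/2 ≤ eᵘ` at `u = log θ`). -/
theorem eqM_log_sq_le_two_mul {θ : ℝ} (h : 1 ≤ θ) : Real.log θ ^ 2 ≤ 2 * θ := by
  have hu : 0 ≤ Real.log θ := Real.log_nonneg h
  have h2 := Real.quadratic_le_exp_of_nonneg hu
  rw [Real.exp_log (by linarith)] at h2
  linarith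

/-- **Warm/cold split.** If `ρθ ≤ (2/3)e`, `0 ≤ ρ < 3`, `θ > 0`, and the cold statistic `cT ≥ 0` dominates
`ρ(1 + log²θ)` whenever `θ ≤ Θ/4`, then `ρ log²θ ≤ cT + 3 log²(Θ/4) + (4/3)e`. -/
theorem eqM_rho_log_sq_le {ρ θ e Θ cT : ℝ} (hρ : 0 ≤ ρ) (hρ3 : ρ < 3) (hθ : 0 < θ) (hΘ : 0 < Θ)
    (hρθ : ρ * θ ≤ 2 / 3 * e) (he : 0 ≤ e) (hcT : 0 ≤ cT)
    (hcold : θ ≤ Θ / 4 → ρ * (1 + Real.log θ ^ 2) ≤ cT) :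
    ρ * Real.log θ ^ 2 ≤ cT + 3 * Real.log (Θ / 4) ^ 2 + 4 / 3 * e := by
  have hW : 0 ≤ Real.log (Θ / 4) ^ 2 := sq_nonneg _
  rcases le_or_gt θ (Θ / 4) with hc | hw
  · have h1 := hcold hc
    nlinarith
  · rcases le_or_gt 1 θ with h1 | h1
    · have h2 := mul_le_mul_of_nonneg_left (eqM_log_sq_le_two_mul h1) hρ
      nlinarith
    · have hl1 : Real.log (Θ / 4) < Real.log θ := Real.log_lt_log (by positivity) hw
      have hl2 : Real.log θ < 0 := Real.log_neg hθ h1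
      have hprod : 0 < (Real.log θ - Real.log (Θ / 4)) * (-(Real.log θ + Real.log (Θ / 4))) :=
        mul_pos (by linarith) (by linarith)
      have hsq : Real.log θ ^ 2 ≤ Real.log (Θ / 4) ^ 2 := by nlinarith
      have h2 := mul_le_mul_of_nonneg_left hsq hρ
      have h3 : 0 ≤ (3 - ρ) * Real.log (Θ / 4) ^ 2 := mul_nonneg (by linarith) hW
      nlinarith

/-- **Arithmetic core.** With `g = (3/2) log θ − log ρ − f`, `0 ≤ f ≤ M`, `mₖ² ≤ 2ρe`, `ρ log²ρ ≤ 12` and the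
warm/cold bound on `ρ log²θ`: `ρ|g| + ∑ₖ |g|·|mₖ| ≤ 100(1 + log²(Θ/4) + M + M²)(1 + e + cT)`
(`2|mₖ|A ≤ mₖ²/ρ + ρA² ≤ 2e + ρA²`, `(a+b+c)² ≤ 3(a²+b²+c²)`, `2t ≤ 1 + t²`). -/
theorem eqM_core {ρ e f M W cT lθ lρ : ℝ} (m : V3) (hρ : 0 < ρ) (hρ3 : ρ < 3) (he : 0 ≤ e)
    (hm : ∀ k, m k ^ 2 ≤ 2 * ρ * e) (hf0 : 0 ≤ f) (hfM : f ≤ M)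
    (hL : ρ * lθ ^ 2 ≤ cT + 3 * W + 4 / 3 * e) (hP : ρ * lρ ^ 2 ≤ 12) (hW : 0 ≤ W) (hcT : 0 ≤ cT) :
    ρ * |3 / 2 * lθ - lρ - f| + ∑ k : Fin 3, |3 / 2 * lθ - lρ - f| * |m k|
      ≤ 100 * (1 + W + M + M ^ 2) * (1 + e + cT) := by
  obtain ⟨g, hg⟩ : ∃ g, g = 3 / 2 * lθ - lρ - f := ⟨_, rfl⟩
  obtain ⟨A, hA⟩ : ∃ A, A = 3 / 2 * |lθ| + |lρ| + M := ⟨_, rfl⟩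
  rw [← hg]
  have hM : 0 ≤ M := hf0.trans hfM
  have hgA : |g| ≤ A := by
    rw [hg, hA, abs_le]
    constructor <;> linarith [le_abs_self lθ, neg_abs_le lθ, le_abs_self lρ, neg_abs_le lρ]
  have hA0 : 0 ≤ A := by rw [hA]; positivity
  have hk : ∀ k, |g| * |m k| ≤ e + ρ * A ^ 2 / 2 := by
    intro k
    have h1 : |g| * |m k| ≤ A * |m k| := mul_le_mul_of_nonneg_right hgA (abs_nonneg _)
    have h2 : 2 * ρ * (A * |m k|) ≤ 2 * ρ * (e + ρ * A ^ 2 / 2) := by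
      nlinarith [sq_nonneg (|m k| - ρ * A), sq_abs (m k), hm k]
    have h3 := le_of_mul_le_mul_left h2 (by linarith)
    linarith
  have hA2 : A ^ 2 ≤ 3 * (9 / 4 * lθ ^ 2 + lρ ^ 2 + M ^ 2) := by
    rw [hA]
    nlinarith [sq_nonneg (3 / 2 * |lθ| - |lρ|), sq_nonneg (|lρ| - M), sq_nonneg (3 / 2 * |lθ| - M),
      sq_abs lθ, sq_abs lρ]
  have hρA2 : ρ * A ^ 2 ≤ ρ * (3 * (9 / 4 * lθ ^ 2 + lρ ^ 2 + M ^ 2)) :=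
    mul_le_mul_of_nonneg_left hA2 hρ.le
  have hL1 : ρ * |lθ| ≤ (ρ + ρ * lθ ^ 2) / 2 := by nlinarith [sq_nonneg (|lθ| - 1), sq_abs lθ]
  have hP1 : ρ * |lρ| ≤ (ρ + ρ * lρ ^ 2) / 2 := by nlinarith [sq_nonneg (|lρ| - 1), sq_abs lρ]
  have hρM : ρ * M ≤ 3 * M := by nlinarith
  have hρM2 : ρ * M ^ 2 ≤ 3 * M ^ 2 := by nlinarith [sq_nonneg M]
  have hρg : ρ * |g| ≤ ρ * A := mul_le_mul_of_nonneg_left hgA hρ.le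
  have hρA : ρ * A = 3 / 2 * (ρ * |lθ|) + ρ * |lρ| + ρ * M := by rw [hA]; ring
  rw [Fin.sum_univ_three]
  have h0 := hk 0
  have h1 := hk 1
  have h2 := hk 2
  nlinarith [mul_nonneg hW he, mul_nonneg hW hcT, mul_nonneg hM he, mul_nonneg hM hcT,
    mul_nonneg (sq_nonneg M) he, mul_nonneg (sq_nonneg M) hcT]

/-- **Abstract majorant of the static integrand** over real data `(ρ, θ, e, m)` with `ρθ ≤ (2/3)e`, `mₖ² ≤ 2ρe`,
a cutoff `c ∈ [0,1]` vanishing above `ρ = 3`, the EOS bound `f_ex ≤ M` on `(0, 3σ³)` and a cold statistic `cT`. -/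
theorem eqM_abstract {σ Θ M ρ θ e c cT : ℝ} (ū m : V3) (hΘ : 0 < Θ) (hM0 : 0 ≤ M)
    (hM : ∀ a : ℝ, 0 < a → a < 3 → hsExcessFreeEnergy (a * σ ^ 3) ≤ M)
    (he0 : 0 ≤ e) (hρθ : ρ * θ ≤ 2 / 3 * e) (hm : ∀ k, m k ^ 2 ≤ 2 * ρ * e)
    (hc0 : 0 ≤ c) (hc1 : c ≤ 1) (hc3 : 3 ≤ ρ → c = 0)
    (hcT0 : 0 ≤ cT) (hcold : θ ≤ Θ / 4 → ρ * (1 + Real.log θ ^ 2) ≤ cT) :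
    |Hs σ ρ θ * c - Hs σ 1 Θ| + ∑ k : Fin 3, |Hs σ ρ θ * c * (m k / ρ) - Hs σ 1 Θ * ū k| ≤
      (|Hs σ 1 Θ| + ∑ k : Fin 3, |Hs σ 1 Θ * ū k| + 100 * (1 + Real.log (Θ / 4) ^ 2 + M + M ^ 2))
        * (1 + e + cT) := by
  -- split off the constant-state values
  have hY0 : 0 ≤ |Hs σ 1 Θ| + ∑ k : Fin 3, |Hs σ 1 Θ * ū k| := by positivity
  have hK0 : 0 ≤ 100 * (1 + Real.log (Θ / 4) ^ 2 + M + M ^ 2) := by positivity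
  have hbase : 1 ≤ 1 + e + cT := by linarith
  have htri : |Hs σ ρ θ * c - Hs σ 1 Θ| + ∑ k : Fin 3, |Hs σ ρ θ * c * (m k / ρ) - Hs σ 1 Θ * ū k| ≤
      (|Hs σ 1 Θ| + ∑ k : Fin 3, |Hs σ 1 Θ * ū k|) +
        (|Hs σ ρ θ * c| + ∑ k : Fin 3, |Hs σ ρ θ * c * (m k / ρ)|) := by
    have h1 := abs_sub (Hs σ ρ θ * c) (Hs σ 1 Θ)
    have h2 : ∑ k : Fin 3, |Hs σ ρ θ * c * (m k / ρ) - Hs σ 1 Θ * ū k| ≤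
        ∑ k : Fin 3, (|Hs σ ρ θ * c * (m k / ρ)| + |Hs σ 1 Θ * ū k|) :=
      Finset.sum_le_sum fun k _ => abs_sub _ _
    rw [Finset.sum_add_distrib] at h2
    linarith
  refine htri.trans ?_
  suffices hmain : |Hs σ ρ θ * c| + ∑ k : Fin 3, |Hs σ ρ θ * c * (m k / ρ)| ≤
      100 * (1 + Real.log (Θ / 4) ^ 2 + M + M ^ 2) * (1 + e + cT) by
    nlinarith
  by_cases hH : Hs σ ρ θ * c = 0
  · rw [hH]
    simp only [abs_zero, zero_mul, Finset.sum_const_zero, add_zero]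
    positivity
  · have hHs : Hs σ ρ θ ≠ 0 := left_ne_zero_of_mul hH
    have hc : c ≠ 0 := right_ne_zero_of_mul hH
    have hguard : 0 < ρ ∧ 0 < θ := by
      by_contra h
      exact hHs (if_neg h)
    have hρ3 : ρ < 3 := by
      by_contra h
      exact hc (hc3 (not_lt.1 h))
    obtain ⟨hρ, hθ⟩ := hguard
    have hHs_eq : Hs σ ρ θ = -(ρ * (3 / 2 * Real.log θ - Real.log ρ - hsExcessFreeEnergy (ρ * σ ^ 3))) :=
      if_pos ⟨hρ, hθ⟩
    set g := 3 / 2 * Real.log θ - Real.log ρ - hsExcessFreeEnergy (ρ * σ ^ 3) with hg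
    have h1 : |Hs σ ρ θ * c| ≤ ρ * |g| := by
      rw [hHs_eq, abs_mul, abs_neg, abs_mul, abs_of_pos hρ, abs_of_nonneg hc0]
      calc ρ * |g| * c ≤ ρ * |g| * 1 := by gcongr
        _ = ρ * |g| := mul_one _
    have h2 : ∀ k, |Hs σ ρ θ * c * (m k / ρ)| ≤ |g| * |m k| := by
      intro k
      have : Hs σ ρ θ * c * (m k / ρ) = -(g * m k * c) := by
        rw [hHs_eq]; field_simp
      rw [this, abs_neg, abs_mul, abs_mul, abs_of_nonneg hc0]
      calc |g| * |m k| * c ≤ |g| * |m k| * 1 := by gcongr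
        _ = |g| * |m k| := mul_one _
    have h3 := Finset.sum_le_sum fun k (_ : k ∈ Finset.univ) => h2 k
    obtain ⟨hf0, hfM⟩ : 0 ≤ hsExcessFreeEnergy (ρ * σ ^ 3) ∧ hsExcessFreeEnergy (ρ * σ ^ 3) ≤ M :=
      ⟨hsExcessFreeEnergy_nonneg _, hM ρ hρ hρ3⟩
    have hcore := eqM_core (W := Real.log (Θ / 4) ^ 2) m hρ hρ3 he0 hm hf0 hfM
      (eqM_rho_log_sq_le hρ.le hρ3 hθ hΘ hρθ he0 hcT0 hcold) (eqM_mul_log_sq_le hρ hρ3) (sq_nonneg _) hcT0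
    linarith

/-- Each component of the coarse momentum obeys `mₖ² ≤ 2ρ_r e_r` (Cauchy–Schwarz in the cone sum, via
`0 ≤ ρ_rθ_r`). -/
theorem eqM_momC_sq_le {r : ℝ} (hr : 0 < r) (w : Phase N) (x : T3) (k : Fin 3) :
    momC r w x k ^ 2 ≤ 2 * rhoC r w x * kinC r w x := by
  by_cases h : rhoC r w x = 0
  · have hk : momC r w x k = 0 := by
      rw [psvK_momC_apply_eq_sum]
      have : ∑ i : Fin (N + 1), cone r (w i).1 x * (w i).2 k = 0 :=
        Finset.sum_eq_zero fun i _ => by rw [psvK_cone_eq_zero_of_rhoC_eq_zero hr h i, zero_mul]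
      rw [this, mul_zero]
    rw [hk, h]
    simp
  · have hρ : 0 < rhoC r w x := lt_of_le_of_ne (rhoC_nonneg hr w x) (Ne.symm h)
    have h0 := psvK_rhoC_mul_thetaC_nonneg hr w x
    rw [psvK_rhoC_mul_thetaC h] at h0
    have h3 : ‖momC r w x‖ ^ 2 / (2 * rhoC r w x) ≤ kinC r w x := by linarith
    rw [div_le_iff₀ (by positivity)] at h3
    have h4 : momC r w x k ^ 2 ≤ ‖momC r w x‖ ^ 2 := by
      rw [EuclideanSpace.real_norm_sq_eq]
      exact Finset.single_le_sum (f := fun i => momC r w x i ^ 2) (fun i _ => sq_nonneg _) (Finset.mem_univ k)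
    linarith

/-- **Stub `eq_majorant`** (line `exact-entropy-ledger-three-passivities`, equilibrium side-composition): the static
`L¹` integrand is dominated, configuration by configuration, by `C (1 + e_r + coldTerm)` with `C` depending only on
`(σ, Θ, ū, η₀, F)`. -/
theorem eq_majorant :
  ∀ (η₀ : ℝ) (F : ℝ → ℝ), EosBand η₀ F → ∀ (σ Θ : ℝ) (ū : V3), 0 < σ → 3 * σ ^ 3 < η₀ → 0 < Θ →
    ∃ C : ℝ, 0 ≤ C ∧ ∀ (N : ℕ) (r : ℝ) (w : Phase N) (x : T3), 0 < r →
      Ystat σ Θ ū r w x ≤ C * (1 + kinC r w x + coldTerm Θ r w x) := by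
  intro η₀ F hE σ Θ ū hσ hσ3 hΘ
  obtain ⟨M₀, hM₀⟩ : ∃ M₀, ∀ η ∈ Set.Icc 0 (3 * σ ^ 3), ‖F η‖ ≤ M₀ :=
    isCompact_Icc.exists_bound_of_continuousOn
      (hE.2.1.continuousOn.mono (Set.Icc_subset_Ioo (by linarith [hE.1]) hσ3))
  have hM : ∀ a : ℝ, 0 < a → a < 3 → hsExcessFreeEnergy (a * σ ^ 3) ≤ max M₀ 0 := by
    intro a ha ha3
    have hσ3pos : 0 < σ ^ 3 := by positivity
    have h0 : 0 ≤ a * σ ^ 3 := by positivity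
    have h1 : a * σ ^ 3 < 3 * σ ^ 3 := by nlinarith
    rw [hE.2.2 ⟨h0, h1.trans hσ3⟩]
    have h2 := hM₀ _ ⟨h0, h1.le⟩
    rw [Real.norm_eq_abs] at h2
    exact ((le_abs_self _).trans h2).trans (le_max_left _ _)
  refine ⟨|Hs σ 1 Θ| + ∑ k : Fin 3, |Hs σ 1 Θ * ū k| +
    100 * (1 + Real.log (Θ / 4) ^ 2 + max M₀ 0 + max M₀ 0 ^ 2), by positivity, ?_⟩
  intro N r w x hr
  have hcold : thetaC r w x ≤ Θ / 4 → rhoC r w x * (1 + Real.log (thetaC r w x) ^ 2) ≤ coldTerm Θ r w x := by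
    intro h
    rw [coldTerm, cutTheta_eq_one hΘ h, mul_one]
  exact eqM_abstract ū (momC r w x) hΘ (le_max_right _ _) hM (kinC_nonneg hr w x)
    (psvK_rhoC_mul_thetaC_le hr w x) (eqM_momC_sq_le hr w x) (cutRho_nonneg _) (cutRho_le_one _)
    (fun h => cutRho_eq_zero h) (coldTerm_nonneg hr w x) hcold

end Summit.AtomisticToContinuum.HydrodynamicLimit.Theorems.LocalSecondLawEquilibrium

end
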